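import Summits.HodgeConjecture.HodgeConjecture.Theorems.LinearSystemTorelliMiddleDivisorSupportCh0NullFrame
import Summits.HodgeConjecture.HodgeConjecture.Theorems.LinearSystemTorelliMiddleDivisorSupportStubWeilProjectorCoefficients
import Summits.HodgeConjecture.HodgeConjecture.Theorems.LinearSystemTorelliMiddleDivisorSupportStubWeilProjectorNormalForm
import Summits.HodgeConjecture.HodgeConjecture.Theorems.LinearSystemTorelliMiddleDivisorSupportBlochPontryaginVanishingOfBloch1976

/-!
# Route LinearSystemTorelli — crux `MiddleDivisorSupport` (stmt-HodgeConjecture-1081), line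
`ch0-null-correspondence-support`: the WEIL-TYPE SECTOR `F1 → Bloch 1976 → S3 → WeilClassSupport`

The sector composition of the line with its two provable stubs DISCHARGED (wave 1, 2026-08-17):
S1 `stub_weilProjectorCoefficients` (p155080) and S2 `stub_weilProjectorNormalForm_of_bloch` (p161003),
and the sector's lean `BlochPontryaginVanishing` discharged from the Literature named fact
`Motives.Bloch1976_pontryaginPower_eq_zero` (Bloch 1976 Thm. 0.1 = Voisin II Thm. 11.29, p163381) by
`blochPontryaginVanishing_of_bloch1976` (p163820). What remains conditional:

* F1 `CorrespondencePackagesExist` (construction debt: Fulton Ch. 6–8 on the tree's Chow groups);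
* the named fact `Bloch1976_pontryaginPower_eq_zero` (published theorem, statement only in the tree);
* S3 `WeilPontryaginIdentity` = (V1_{2n}), the HARDEST stub: `M · W_{2n}(P) = 0` in `CH₀(A)` on
  balanced Weil type — theorem for `n ≤ 2` (Hodge conjecture for the Weil classes + O'Sullivan's
  symmetrically distinguished lift + Kimura finite-dimensionality + Roitman), OPEN from `n = 3` in
  general (Markman 2025 gives the Weil classes on sixfolds of discriminant `-1`).

THE MECHANISM (all proved here or upstream): the Weil projector `Z_q = Σ q(x,y) Γ_{x·𝟙+y·φ}` — a
`ℤ`-combination of graphs of complex multiplications with Weil-projector coefficients `(q, m)` (S1) —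
FIXES every class of the Weil plane up to `m` (`corrAct_weilProjector_eq_smul`, HP on the sector), and
on a balanced Weil-type `(A, φ)` it KILLS a fixed multiple of every point class
(`weilProjector_chowAct_null`: by (K3) `(Z_q)_*{P} = Σ q {(x·𝟙+y·φ)P}`, by S2 this is `(m/M₁)·W_{2n}(P)`,
by S3 it is torsion of bounded order) — so Bloch–Srinivas (K1) and Voisin II (10.8)
(`act_mem_supportedClasses_of_nsmul_null`, frame file) put `m·c`, hence `c`, in `N¹H^{2n}`.
Balancedness is read off the class itself (`finrank_eq_of_mem_weilClassesOf`, Deligne–Milne Prop. 4.4).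

Main result: `weilClassSupport_of_packages_bloch1976_weilPontryagin` (registered sub-goal of
stmt-HodgeConjecture-1081): `CorrespondencePackagesExist → Bloch1976_pontryaginPower_eq_zero →
WeilPontryaginIdentity → WeilClassSupport`. No definition, no new named fact.

## References

* [VoisinHodgeII2003] C. Voisin, Hodge Theory and Complex Algebraic Geometry II, Cor. 10.20, (10.8),
  Thm. 11.29, Conj. 11.22.
* [vanGeemen1994HodgeAV] B. van Geemen, An introduction to the Hodge conjecture for abelian varieties,
  4.8–4.9, Thm. 6.12.
* [Bloch1976] S. Bloch, Some elementary theorems about algebraic cycles on Abelian varieties, Thm. 0.1.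
* [Deligne1982HodgeCycles] P. Deligne (notes by J. Milne), Hodge cycles on abelian varieties, Prop. 4.4.
* [Markman2025SurveySecant] E. Markman, Cycles on abelian 2n-folds of Weil type …, §1.1.
-/

noncomputable section

-- `Summit.HodgeConjecture.HodgeConjecture.Theorems` is the mandated namespace (single-problem summit:
-- Problem = Summit), which `linter.dupNamespace` flags on every declaration; the lakefile turns the
-- linter off tree-wide (weak option), restated here so stand-alone elaboration is warning-free too.
set_option linter.dupNamespace false

namespace Summit.HodgeConjecture.HodgeConjecture.Theorems.Ch0Null

open CategoryTheory AlgebraicGeometry MonoidalCategory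
open Literature.AlgebraicGeometry Literature.AlgebraicGeometry.HodgeTheory
open Literature.AlgebraicGeometry.Motives
open Literature.AlgebraicTopology.SingularHomology
open scoped BigOperators

/-! ### Linear-combination bookkeeping for the two actions -/

/-- Cohomological action of a `ℤ`-combination of cycles, applied to a class. [folklore] -/
theorem corrAct_sum_zsmul_apply {p : ℕ} {X : SchemeOver ℂ} (C : CorrespondenceAction (2 * p) X)
    {ι : Type*} (s : Finset ι) (k : ι → ℤ) (Γ : ι → ↥(cyclesOfDim (X ⊗ X).left (2 * p))) (r : ℕ)
    (c : complexBetti X r) :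
    C.act r (∑ i ∈ s, k i • Γ i) c = ∑ i ∈ s, k i • C.act r (Γ i) c := by
  rw [map_sum, LinearMap.sum_apply]
  refine Finset.sum_congr rfl fun i _ => ?_
  rw [map_zsmul, LinearMap.smul_apply]

/-- Chow action of a `ℤ`-combination of cycles on a point class. [folklore] -/
theorem chowAct_sum_zsmul_apply {p : ℕ} {X : SchemeOver ℂ} (Act : CorrespondenceChowAction (2 * p) X X)
    {ι : Type*} (s : Finset ι) (k : ι → ℤ) (Γ : ι → ↥(cyclesOfDim (X ⊗ X).left (2 * p)))
    (x : ChowGroup X.left 0) :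
    chowAct Act (∑ i ∈ s, k i • Γ i) x = ∑ i ∈ s, k i • chowAct Act (Γ i) x := by
  unfold chowAct
  rw [map_sum, map_sum, AddMonoidHom.finsetSum_apply]
  refine Finset.sum_congr rfl fun i _ => ?_
  rw [map_zsmul, map_zsmul, AddMonoidHom.zsmul_apply]

/-- A Weil character sum at `K`-type `(2n, 0)` equals `m`. [cite: vanGeemen1994HodgeAV, proof of Thm. 6.12] -/
theorem weilProjector_sum_plus {n d : ℕ} {q : ℕ × ℕ →₀ ℤ} {m : ℕ}
    (hq : IsWeilProjectorCoefficients n d q m) :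
    (∑ xy ∈ q.support, (q xy : ℂ) * ((xy.1 : ℂ) + (xy.2 : ℂ) * Complex.I * (Real.sqrt d : ℂ)) ^ (2 * n))
      = (m : ℂ) := by
  have h := hq (2 * n) 0 le_rfl (Nat.zero_le _)
  simp only [weilCharacter, pow_zero, mul_one, and_true, true_or, if_true] at h
  exact h

/-- A Weil character sum at `K`-type `(0, 2n)` equals `m`. [cite: vanGeemen1994HodgeAV, proof of Thm. 6.12] -/
theorem weilProjector_sum_minus {n d : ℕ} {q : ℕ × ℕ →₀ ℤ} {m : ℕ}
    (hq : IsWeilProjectorCoefficients n d q m) :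
    (∑ xy ∈ q.support, (q xy : ℂ) * ((xy.1 : ℂ) - (xy.2 : ℂ) * Complex.I * (Real.sqrt d : ℂ)) ^ (2 * n))
      = (m : ℂ) := by
  have h := hq 0 (2 * n) (Nat.zero_le _) le_rfl
  simp only [weilCharacter, pow_zero, one_mul, and_true, or_true, if_true] at h
  exact h

/-! ### HP on the sector: the Weil projector fixes the Weil plane -/

/-- **The Weil projector cycle fixes the Weil plane up to `m`** (HP on the sector): if `(q, m)` are
Weil-projector coefficients and the cycles `Γ x y` act on cohomology as `(x·𝟙 + y·φ)^*` (package (K3)),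
then `Z_q = Σ q(x,y) Γ_{x,y}` acts on every `c ∈ E₊ ⊔ E₋ = weilClassesOf A φ n d` by `[Z_q]^* c = m · c`
(the Hodge-isolating correspondence is an explicit `ℤ`-combination of graphs of complex
multiplications). [cite: vanGeemen1994HodgeAV, 4.9 and proof of Thm. 6.12] -/
theorem corrAct_weilProjector_eq_smul {A : AbelianVariety ℂ} {φ : A ⟶ A} {n d : ℕ}
    (C : CorrespondenceAction (2 * n) A.X) {q : ℕ × ℕ →₀ ℤ} {m : ℕ}
    (hq : IsWeilProjectorCoefficients n d q m)
    (Γ : ℕ × ℕ → ↥(cyclesOfDim (A.X ⊗ A.X).left (2 * n)))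
    (hΓ : ∀ xy : ℕ × ℕ, ∀ r : ℕ, C.act r (Γ xy) = (complexBetti.map (xy.1 • 𝟙 A + xy.2 • φ).hom.hom.hom r).hom)
    {c : complexBetti A.X (2 * n)} (hc : c ∈ weilClassesOf A φ n d) :
    C.act (2 * n) (∑ xy ∈ q.support, q xy • Γ xy) c = (m : ℂ) • c := by
  rw [weilClassesOf, Submodule.mem_sup] at hc
  obtain ⟨c₁, h₁, c₂, h₂, rfl⟩ := hc
  rw [corrAct_sum_zsmul_apply]
  have e₁ : ∀ xy ∈ q.support, q xy • C.act (2 * n) (Γ xy) (c₁ + c₂) =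
      ((q xy : ℂ) * ((xy.1 : ℂ) + (xy.2 : ℂ) * Complex.I * (Real.sqrt d : ℂ)) ^ (2 * n)) • c₁ +
      ((q xy : ℂ) * ((xy.1 : ℂ) - (xy.2 : ℂ) * Complex.I * (Real.sqrt d : ℂ)) ^ (2 * n)) • c₂ := by
    intro xy _
    rw [hΓ xy (2 * n), map_add]
    have t₁ := (mem_weilClassesPlus_iff.mp h₁) xy.1 xy.2
    have t₂ := (mem_weilClassesMinus_iff.mp h₂) xy.1 xy.2
    change q xy • ((singularCohomology.map ℂ ℂ
        (AlgPoints.mapContinuous (L := ℂ) (xy.1 • 𝟙 A + xy.2 • φ).hom.hom.hom) (2 * n) c₁) +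
      (singularCohomology.map ℂ ℂ
        (AlgPoints.mapContinuous (L := ℂ) (xy.1 • 𝟙 A + xy.2 • φ).hom.hom.hom) (2 * n) c₂)) = _
    rw [t₁, t₂, smul_add, ← Int.cast_smul_eq_zsmul ℂ, ← Int.cast_smul_eq_zsmul ℂ, smul_smul, smul_smul]
  rw [Finset.sum_congr rfl e₁, Finset.sum_add_distrib, ← Finset.sum_smul, ← Finset.sum_smul,
    weilProjector_sum_plus hq, weilProjector_sum_minus hq, smul_add]

/-! ### GB₀ on the sector: the Weil projector is CH₀-null (S2 landed, S3 open) -/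

/-- **The Weil projector kills a fixed multiple of every point class ⟸ S3**, with S2
(`stub_weilProjectorNormalForm_of_bloch`, landed) and Bloch's theorem (the Literature fact, through
`blochPontryaginVanishing_of_bloch1976`): if the cycles `Γ_{x,y}` act on point classes as the
endomorphisms `x·𝟙 + y·φ` (package (K3)), then on a balanced Weil-type `(A, φ)` the projector cycle
`Z_q = Σ q(x,y) Γ_{x,y}` kills `M · {P}` for ONE `M ≥ 1` and every complex point `P`.
[cite: VoisinHodgeII2003, Thm. 11.29 and Conj. 11.22] [cite: Bloch1976, Thm. 0.1] -/
theorem weilProjector_chowAct_null (hB : Bloch1976_pontryaginPower_eq_zero) (s₃ : WeilPontryaginIdentity)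
    {A : AbelianVariety ℂ} {φ : A ⟶ A} {n d : ℕ} (hn : 0 < n) (hd : 0 < d) (hA : A.dim = 2 * n)
    (hφ : φ ≫ φ = -(d • 𝟙 A))
    (hbal : Module.finrank ℂ ↥(Module.End.eigenspace (complexBetti.map φ.hom.hom.hom 1).hom
          (Complex.I * (Real.sqrt d : ℂ)) ⊓
        hodgeOneZero (isSmoothProjective_of_dim_eq' hA)) = n)
    (Act : CorrespondenceChowAction (2 * n) A.X A.X) {q : ℕ × ℕ →₀ ℤ} {m : ℕ} (hm : 0 < m)
    (hq : IsWeilProjectorCoefficients n d q m)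
    (Γ : ℕ × ℕ → ↥(cyclesOfDim (A.X ⊗ A.X).left (2 * n)))
    (hΓ : ∀ (xy : ℕ × ℕ) (P : ComplexPoints A.X), chowAct Act (Γ xy) (pointClass A.X P) =
      pointClass A.X (AlgPoints.map (xy.1 • 𝟙 A + xy.2 • φ).hom.hom.hom P)) :
    ∃ M : ℕ, 0 < M ∧ ∀ P : ComplexPoints A.X,
      M • chowAct Act (∑ xy ∈ q.support, q xy • Γ xy) (pointClass A.X P) = 0 := by
  obtain ⟨M₁, M₂, hM₁, hnf⟩ := stub_weilProjectorNormalForm_of_bloch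
    (blochPontryaginVanishing_of_bloch1976 hB) A φ n d hn hd hA hφ q m hm hq
  obtain ⟨M, hM, hV1⟩ := s₃ A φ n d hn hd hA hφ hbal
  have hpt : ∀ P : A.Points ℂ, chowAct Act (∑ xy ∈ q.support, q xy • Γ xy) (pointClass A.X P) =
      weilProjectorOnPoint A φ q P := by
    intro P
    rw [chowAct_sum_zsmul_apply]
    refine Finset.sum_congr rfl fun xy _ => ?_
    rw [hΓ xy P]
    rfl
  refine ⟨M * M₁, Nat.mul_pos hM hM₁, fun P => ?_⟩
  rw [hpt P, mul_nsmul', hnf P, smul_comm, hV1 P, smul_zero]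

/-! ### The sector composition -/

/-- **THE WEIL-TYPE SECTOR: F1 ∧ Bloch 1976 ∧ S3 ⟹ `WeilClassSupport`** (S1 and S2 discharged).
Given a rational `(n,n)` Weil class `c ≠ 0` of an abelian `2n`-fold with `φ² = -d`: the type is
balanced (Deligne–Milne Prop. 4.4, tree `finrank_eq_of_mem_weilClassesOf`); take the package `(Act, C)`
of `A` (F1), coefficients `(q, m)` (S1, landed), graph cycles `Γ_{x,y}` (K3) and `Z_q = Σ q(x,y) Γ_{x,y}`;
then `[Z_q]^* c = m c` (`corrAct_weilProjector_eq_smul`) and `Z_q` is CH₀-null up to one integer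
(`weilProjector_chowAct_null`: S2 landed + Bloch 1976 + S3), so Bloch–Srinivas (K1, Voisin II Cor. 10.20
with (10.8): `act_mem_supportedClasses_of_nsmul_null`) puts `m c` in `N¹`, hence `c`. Conditional on
F1 (construction debt), the named fact `Bloch1976_pontryaginPower_eq_zero` and the open stub S3
`WeilPontryaginIdentity`; registered sub-goal `weilClassSupport_of_packages_bloch1976_weilPontryagin`
of stmt-HodgeConjecture-1081. [cite: VoisinHodgeII2003, Cor. 10.20 and (10.8)]
[cite: Deligne1982HodgeCycles, Prop. 4.4] -/
theorem weilClassSupport_of_packages_bloch1976_weilPontryagin : CorrespondencePackagesExist → Bloch1976_pontryaginPower_eq_zero → WeilPontryaginIdentity → WeilClassSupport := by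
  intro h₁ hB s₃ A φ n d hn hd hA hφ c hcW hrat hH
  by_cases hc0 : c = 0
  · rw [hc0]; exact Submodule.zero_mem _
  have hX : IsSmoothProjective (2 * n) A.X := isSmoothProjective_of_dim_eq' hA
  have hbal := finrank_eq_of_mem_weilClassesOf hn hA hd hφ hcW hc0 hH
  obtain ⟨Act, C, hP⟩ := h₁ (Nat.one_le_iff_ne_zero.mpr hn.ne') hX
  obtain ⟨q, m, hm, hq⟩ := stub_weilProjectorCoefficients n d hn hd
  choose Γ hΓC hΓA using fun xy : ℕ × ℕ => hP.graphs (xy.1 • 𝟙 A + xy.2 • φ).hom.hom.hom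
  obtain ⟨M, hM, hnull⟩ := weilProjector_chowAct_null hB s₃ hn hd hA hφ hbal Act hm hq Γ hΓA
  have hmem := act_mem_supportedClasses_of_nsmul_null hX hP _ hM hnull (2 * n) c
  rw [corrAct_weilProjector_eq_smul C hq Γ hΓC hcW, Nat.cast_smul_eq_nsmul] at hmem
  exact mem_of_nsmul_mem _ hm hmem

end Summit.HodgeConjecture.HodgeConjecture.Theorems.Ch0Null

end
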